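import Summits.BirchSwinnertonDyer.BirchSwinnertonDyer.Theorems.UniversalToricDescentTwinWanFrameAtThreeMultTresTAllSplit
import Summits.BirchSwinnertonDyer.BirchSwinnertonDyer.Theorems.ErratumRoadFiveErratumThm23DecOfTwoVarCore
import Summits.BirchSwinnertonDyer.BirchSwinnertonDyer.Theorems.ErratumRoadFiveIMCDivMemberDivisibleMember
import HarnessLib

/-!
# Route `UniversalToricDescent`, crux K1-at-3 (stmt-BirchSwinnertonDyer-27934) / ♭B′ `TwinWanFrameAtThreeMultTresT` (27401):
# the line's research stub K1♯ REDUCED, in the kernel, to a TWO-VARIABLE core at `p = 3` — the descent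
# [JSW17, Cor. 3.4.2] and the exact control [JSW17, Lemma 3.4.1] for the Hida members are DISCHARGED at `p = 3`

Width seat bsd-wall-utd-p2-w2 g8 (2026-08-28), `--supports stmt-BirchSwinnertonDyer-27401` (helper). Theorems only (no definition, no named fact, no `sorry`).

## What this file proves

Write K1♯ for the registered stub `stub_memberRationalInclusionAtThree` of line `membertower` v14 (sha `8ce0a415332e`; K1 =
`TwinMemberRationalInclusionAtThree` confined to depth `m ≥ 1` and residually irreducible members), K1♯ᵈ for K1♯ with ONE
extra binder after `IsResiduallyIrreducible D.Δ →` — (dec) «`A_{g_m}` has no non-zero `Γ_{K_𝔭′}`-fixed `3`-power torsion»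
(erratum Lemma 2.1's «`H⁰(K_𝔭̄, A_g[ϖ]) = 0`») — and TV₃ for the TWO-VARIABLE CORE at the same data: for every CYCLOTOMIC
`ℤ₃`-extension `κ′` of `K` with a generator, IF the Σ-imprimitive Selmer dual `X^Σ_K(A_{g_m}) := XBig κ′ (AnticyclotomicBigGaloisRep κ (A_{g_m}|Γ_K)) 𝔭′ Σ`
of the two-variable big representation over `Λ_K = 𝒪⟦T_a⟧⟦T_c⟧` (the ITERATE of the tree's co-induced model — no new
carrier) is `Λ_K`-torsion THEN some `Q₂ ∈ 𝓞_{ℂ₃}⟦T_a⟧⟦T_c⟧` contains `Ch_{Λ_K}(X^Σ_K(A_{g_m}))·𝓞_{ℂ₃}⟦T_a⟧⟦T_c⟧` and restricts on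
`T_c = 0` to `u · Q`, `u` a unit, `Q` the member's Σ-frame (`IsBDPLFunctionWtSigmaInt`) — the shape of bsd-stepL's
`stub_FW21_twoVarSigmaLePinned` (S1 of crux 25505 `ErratumThm23SigmaLe`) with `3 < p` and hypothesis (iii) REMOVED and the
member/twin binders of K1♯ in their place.

* §1 `sharpDec_of_twoVarCoreAtThree : TV₃ → K1♯ᵈ` — bsd-stepL's `ErratumChainDec.erratumThm23SigmaLe_dec_of_twoVarCore`
  (imc-p1 g22) RE-RUN AT `p = 3` on the member data: (glob) from `IsResiduallyIrreducible D.Δ`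
  (`IrrK.noFixedTorsion_of_isResiduallyIrreducible`, which needs only `p ≠ 2` and `[K:ℚ] = 2`), (unr) outside `Σ ⊇ {w ∣ N′/3}`
  (`cofreeRepOver_localMap_inr_apply_eq_self`, `mem_sigmaPlaces_of_tameLevel_mem`), finite generation
  (`SkinnerUrban2014.moduleFinite_XBig_newform`), the EXACT two-variable control (`ControlAt.exists_controlMap` — generic in
  `p`), a cyclotomic `κ′` (`exists_cyclotomicZpExtension_holds`), two-variable torsion by the determinant trick and the descent
  of the characteristic ideal along `T_c ↦ 0` (`TwoVariableDescent.*`, `CoeffRing.*`); exponent `e = 0`.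
* §2 `twinWanFrameAtThreeMultTresT_of_thmB_of_allSplitMembersFrames_of_decIrredMemberRationalInclusion` — ♭B′ 27401 BY NAME
  from Hsieh Thm B, the consumer-minimal odd-`p` member/frame statement `C_min` (inline, as in p645093) and K1♯ᵈ: the LINE
  NEEDS ONLY K1♯ᵈ, because ♭B′'s très-ramifié binder gives (dec) for the twin (`twin_dec_of_forall_not_cube`: `W′(ℚ₃)[3] = 0`)
  and the congruence (b) at depth `m ≥ 1` transports it to every member (`RoadFFMember.forall_fixed_primary_eq_zero_cofreeRepOver`
  over `BigRep.hdec_geomPoints_of_padicTorsion`, `K_𝔭′ ≃ ℚ₃` at the degree-one prime `𝔭′`). Proof = p645093's core + that line.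
* §3 `twinWanFrameAtThreeMultTresT_of_thmB_of_nonsplitMembersFrames_of_twoVarCoreAtThree` — ♭B′ BY NAME from the two
  Literature facts of the line (Hsieh Thm B 20711, `…_odd_nonsplit` 22593) and TV₃: the composition §2 ∘ p645093's
  `allSplitMembersFrames_of_nonsplitMembersFrames` ∘ §1. A candidate skeleton `membertower` v15 is
  {`stub_thmB`, `stub_pubMembersFramesCongruence`, `stub_twoVarCoreAtThree` := TV₃} with this theorem as the composition.

READING (numbers, not adjectives). K1♯ as registered is STRONGER than what the two-variable road delivers: it also covers
members in the `¬(dec)` corner (a `Γ_{ℚ₃}`-fixed `3`-torsion point on `A_g`), where the descent [JSW17, Cor. 3.4.2] is not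
available (bsd-stepL memo CORNER-25505); the twin's très-ramifié binder keeps the line OUT of that corner, so confining the stub to
K1♯ᵈ loses nothing. What remains research after this file is TV₃ alone — a two-variable Σ-imprimitive Greenberg-side
divisibility for a `3`-ordinary newform of even weight `k > 2` congruent to the twin, over the `ℤ₃²`-extension of an all-split
`K`, pinned to the BDP frame: the OUTPUT SHAPE of the weight-`k` port of [YanZhu2026, Thm. 4.4/4.7] before descent; the descent
step of the port work-order (LENS-MEMO v26 §2, LEAD-NOTE-g16 §2) is in the kernel at `p = 3`. No engine for TV₃ is in print at
`p = 3` (FW21 Thm. 4.41 needs a non-split `q ∥ N`; KLZ17 §7.2 `p ≥ 5`). Items closed 0; classes closed 0; BSD is proved for no curve.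

References: [Castella2018Erratum] L. 2.1, (2.4)–(2.5); [JetchevSkinnerWan2017] §3.4, L. 3.4.1, Cor. 3.4.2; [Skinner2016PacificMC] §3.1 (a)(b); [Hsieh2014] Thm. B; [Castella2020JIMJ] Thm. 2.11; [FouquetWan2021] Thm. 4.41; [YanZhu2026] Thm. 4.4, 4.7. -/

noncomputable section

open scoped Classical

set_option linter.dupNamespace false
set_option autoImplicit false

namespace Summit.BirchSwinnertonDyer.BirchSwinnertonDyer.Theorems.UniversalToricDescentTwinMemberRationalInclusionAtThreeOfTwoVarCore

open PowerSeries WeierstrassCurve NumberField IsDedekindDomain Field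
  Literature.NumberTheory.EllipticCurves
  Literature.NumberTheory.EllipticCurves.ModularForms
  Literature.NumberTheory.EllipticCurves.Rank1Residual
  Literature.NumberTheory.EllipticCurves.BigGaloisRep
  Literature.NumberTheory.EllipticCurves.GreenbergSelmer
  Literature.NumberTheory.GaloisRepresentations
  Summit.BirchSwinnertonDyer.Rank1Residual.X11b
  Summit.BirchSwinnertonDyer.Rank1Residual.X11b.Halves
  Summit.BirchSwinnertonDyer.BirchSwinnertonDyer.Theorems.SchneiderFree
  Summit.BirchSwinnertonDyer.BirchSwinnertonDyer.Theorems.UniversalToricDescentTwinTorsionRankOne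
  Summit.BirchSwinnertonDyer.BirchSwinnertonDyer.Theorems.UniversalToricDescentTwinDecLocus
  Summit.BirchSwinnertonDyer.BirchSwinnertonDyer.Theorems.ErratumThm23TwoVariable
  Summit.BirchSwinnertonDyer.BirchSwinnertonDyer.Theses.UniversalToricDescent

/-! ## §1 K1♯ᵈ from the two-variable core at `p = 3` -/

set_option maxHeartbeats 800000 in
-- statement-sized packages over the iterated big representation (as bsd-stepL's p634294); the proof is glue
/-- **K1♯ᵈ ⟸ TV₃.** The hypothesis `hTV` is the two-variable core at the member data of K1♯ (see the module docstring);
the conclusion is K1♯ (the v14 stub text VERBATIM) with the single extra binder (dec) after `IsResiduallyIrreducible D.Δ →`.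
Proof: bsd-stepL's `ErratumChainDec.erratumThm23SigmaLe_dec_of_twoVarCore` at `p = 3` — (glob) from irreducibility
(`p ≠ 2`, `[K:ℚ] = 2`), (unr) outside `Σ`, `X^Σ_ac(A_g)` finitely generated, EXACT two-variable control, a cyclotomic `κ′`,
two-variable torsion from the one-variable premise, descent of `Ch` along `T_c ↦ 0`, exponent `e = 0`.
[cite: JetchevSkinnerWan2017, §3.4, Lemma 3.4.1 and Cor. 3.4.2 (arXiv:1512.06894 p. 14)]
[cite: Castella2018Erratum, Lemma 2.1 (p. 2) and proof of Thm. 2.3, (2.4) ⇒ (2.5) (p. 4)] -/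
theorem sharpDec_of_twoVarCoreAtThree
    (hTV :
    ∀ (W' : WeierstrassCurve ℚ) [W'.IsElliptic] [W'.IsGloballyMinimal] (N' : ℕ) [NeZero N']
      (K : Type) [Field K] [NumberField K] (Dt' : ModularParametrizationData W' N'),
      Mult W' 3 → W'.HasSurjectiveModNGaloisRep 3 → W'.conductorNorm ℤ = N' → IsImaginaryQuadratic K →
      SatisfiesHeegnerHypothesis N' K → Odd (NumberField.discr K) →
      ∀ (κ : ZpExtension K 3), κ.IsAnticyclotomic → ∀ (γ : absoluteGaloisGroup K) [Fact (κ.IsTopGenerator γ)]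
        (𝔭 : HeightOneSpectrum (𝓞 K)), ((3 : ℕ) : 𝓞 K) ∈ 𝔭.asIdeal →
        𝔭.asIdeal.ramificationIdx (𝓞 ℚ) = 1 → 𝔭.asIdeal.inertiaDeg (𝓞 ℚ) = 1 →
        ∀ (𝔭' : HeightOneSpectrum (𝓞 K)), ((3 : ℕ) : 𝓞 K) ∈ 𝔭'.asIdeal → 𝔭' ≠ 𝔭 →
        ∀ (ι' : PadicAlgCl 3 ≃+* ℂ), BranchInducesPrime 3 ι' 𝔭 →
        ∀ (m : ℕ), 1 ≤ m → ∀ (D : Skinner2016.HidaCongruentMember W' 3 m),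
          SkinnerUrban2014.IsResiduallyIrreducible D.Δ →
          (∀ a : Cofree D.Δ.ρ (padicCoeffField D.ι),
              (∀ σ : LocalGroup K (Sum.inl 𝔭'), (D.Δ.cofreeRepOver K) (localMap K (Sum.inl 𝔭') σ) a = a) →
              (∃ j : ℕ, (3 : ℕ) ^ j • a = 0) → a = 0) →
          (∀ x : coeffField D.g, ι' (D.ι x) = (x : ℂ)) →
        ∀ (b : padicCoeffIntegers D.ι →+* 𝓞_ℂ_[3]),
          (∀ x, ((b x : 𝓞_ℂ_[3]) : ℂ_[3]) = algebraMap (PadicAlgCl 3) ℂ_[3] (padicCoeffIntegers.toPadicAlgCl D.ι x)) →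
        ∀ (ΩK : ℂ) (Ωp : (𝓞_ℂ_[3])ˣ) (Q : PowerSeries 𝓞_ℂ_[3]), ΩK ≠ 0 →
          IsBDPLFunctionWtSigmaInt ι' 𝔭 κ γ D.g (W'.sigmaPlacesFinset 3 K) ΩK ((Ωp : 𝓞_ℂ_[3]) : ℂ_[3]) Q →
        ∀ (κ' : ZpExtension K 3) (γ' : absoluteGaloisGroup K) [Fact (κ'.IsTopGenerator γ')], κ'.IsCyclotomic →
        ∀ [TopologicalSpace (PowerSeries (padicCoeffIntegers D.ι))]
          [TopologicalSpace (PowerSeries (PowerSeries (padicCoeffIntegers D.ι)))]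
          [ContinuousSMul (PowerSeries (PowerSeries (padicCoeffIntegers D.ι)))
            (BigRepModule (PowerSeries (padicCoeffIntegers D.ι)) 3
              (BigRepModule (padicCoeffIntegers D.ι) 3 (Cofree D.Δ.ρ (padicCoeffField D.ι))))],
          Module.IsTorsion (PowerSeries (PowerSeries (padicCoeffIntegers D.ι)))
              (XBig κ' (AnticyclotomicBigGaloisRep κ (D.Δ.cofreeRepOver K)) 𝔭' (↑(W'.sigmaPlacesFinset 3 K))) →
            ∃ Q₂ : PowerSeries (PowerSeries 𝓞_ℂ_[3]),
              (∃ u : (PowerSeries 𝓞_ℂ_[3])ˣ, PowerSeries.constantCoeff Q₂ = (u : PowerSeries 𝓞_ℂ_[3]) * Q) ∧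
              (XBig.charIdeal κ' (AnticyclotomicBigGaloisRep κ (D.Δ.cofreeRepOver K)) 𝔭'
                  (↑(W'.sigmaPlacesFinset 3 K))).map (PowerSeries.map (PowerSeries.map b)) ≤ Ideal.span {Q₂}) :
    ∀ (W' : WeierstrassCurve ℚ) [W'.IsElliptic] [W'.IsGloballyMinimal] (N' : ℕ) [NeZero N']
      (K : Type) [Field K] [NumberField K] (Dt' : ModularParametrizationData W' N'),
      Mult W' 3 → W'.HasSurjectiveModNGaloisRep 3 → W'.conductorNorm ℤ = N' → IsImaginaryQuadratic K →
      SatisfiesHeegnerHypothesis N' K → Odd (NumberField.discr K) →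
      ∀ (κ : ZpExtension K 3), κ.IsAnticyclotomic → ∀ (γ : absoluteGaloisGroup K) [Fact (κ.IsTopGenerator γ)]
        (𝔭 : HeightOneSpectrum (𝓞 K)), ((3 : ℕ) : 𝓞 K) ∈ 𝔭.asIdeal →
        𝔭.asIdeal.ramificationIdx (𝓞 ℚ) = 1 → 𝔭.asIdeal.inertiaDeg (𝓞 ℚ) = 1 →
        ∀ (𝔭' : HeightOneSpectrum (𝓞 K)), ((3 : ℕ) : 𝓞 K) ∈ 𝔭'.asIdeal → 𝔭' ≠ 𝔭 →
        ∀ (ι' : PadicAlgCl 3 ≃+* ℂ), BranchInducesPrime 3 ι' 𝔭 →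
        ∀ (m : ℕ), 1 ≤ m → ∀ (D : Skinner2016.HidaCongruentMember W' 3 m),
          SkinnerUrban2014.IsResiduallyIrreducible D.Δ →
          (∀ a : Cofree D.Δ.ρ (padicCoeffField D.ι),
              (∀ σ : LocalGroup K (Sum.inl 𝔭'), (D.Δ.cofreeRepOver K) (localMap K (Sum.inl 𝔭') σ) a = a) →
              (∃ j : ℕ, (3 : ℕ) ^ j • a = 0) → a = 0) →
          (∀ x : coeffField D.g, ι' (D.ι x) = (x : ℂ)) →
        ∀ (b : padicCoeffIntegers D.ι →+* 𝓞_ℂ_[3]),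
          (∀ x, ((b x : 𝓞_ℂ_[3]) : ℂ_[3]) = algebraMap (PadicAlgCl 3) ℂ_[3] (padicCoeffIntegers.toPadicAlgCl D.ι x)) →
        ∀ (ΩK : ℂ) (Ωp : (𝓞_ℂ_[3])ˣ) (Q : PowerSeries 𝓞_ℂ_[3]), ΩK ≠ 0 →
          IsBDPLFunctionWtSigmaInt ι' 𝔭 κ γ D.g (W'.sigmaPlacesFinset 3 K) ΩK ((Ωp : 𝓞_ℂ_[3]) : ℂ_[3]) Q →
        ∀ [TopologicalSpace (PowerSeries (padicCoeffIntegers D.ι))]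
          [ContinuousSMul (PowerSeries (padicCoeffIntegers D.ι))
            (BigRepModule (padicCoeffIntegers D.ι) 3 (Cofree D.Δ.ρ (padicCoeffField D.ι)))],
          Module.IsTorsion (PowerSeries (padicCoeffIntegers D.ι))
              (XBig κ (D.Δ.cofreeRepOver K) 𝔭' (↑(W'.sigmaPlacesFinset 3 K))) →
            ∃ e : ℕ, Ideal.span {(PowerSeries.C ((3 : ℕ) : 𝓞_ℂ_[3]) : PowerSeries 𝓞_ℂ_[3]) ^ e} *
                (XBig.charIdeal κ (D.Δ.cofreeRepOver K) 𝔭' (↑(W'.sigmaPlacesFinset 3 K))).map (PowerSeries.map b) ≤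
              Ideal.span {Q} := by
  intro W' _ _ N' _ K _ _ Dt' hmult hsurj hN' hK hH hodd κ hκ γ _ 𝔭 h𝔭 he hf 𝔭' h𝔭' hne ι' hι' m hm D hirr hdec hι b hb
    ΩK Ωp Q hΩK hQ _i1 _i2 hT
  -- ### level bookkeeping: `3 ∣ N′`, `3 ∤ N′/3`, `N′/3 ≠ 0`
  have hpN : 3 ∣ W'.conductorNorm ℤ := dvd_conductorNorm_of_mult hmult
  have hN0 : W'.conductorNorm ℤ ≠ 0 := (W'.conductorNorm_pos_holds).ne'
  have hpM : ¬ 3 ∣ W'.conductorNorm ℤ / 3 := by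
    have hfac := W'.factorization_conductorNorm_eq_one_of_hasMultiplicativeReductionAtPrime 3 hmult
    intro h
    have h2 : 3 ^ 2 ∣ W'.conductorNorm ℤ := by
      rw [pow_two]
      exact Nat.mul_dvd_of_dvd_div hpN h
    have := ((Fact.out : (3 : ℕ).Prime).pow_dvd_iff_le_factorization hN0).mp h2
    omega
  haveI : NeZero (W'.conductorNorm ℤ / 3) :=
    ⟨(Nat.div_pos (Nat.le_of_dvd (Nat.pos_of_ne_zero hN0) hpN) (by norm_num)).ne'⟩
  -- ### `Σ` contains every place dividing the tame level `N′/3`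
  have hSM : ∀ w : HeightOneSpectrum (𝓞 K), w ∉ (↑(W'.sigmaPlacesFinset 3 K) : Set (HeightOneSpectrum (𝓞 K))) →
      ((W'.conductorNorm ℤ / 3 : ℕ) : 𝓞 K) ∉ w.asIdeal := by
    intro w hw hM'
    rw [WeierstrassCurve.coe_sigmaPlacesFinset] at hw
    exact hw (WeierstrassCurve.mem_sigmaPlaces_of_tameLevel_mem hpN hpM hM')
  -- ### (glob) from irreducibility (`p = 3 ≠ 2`, `[K:ℚ] = 2`)
  have hglob : ∀ a : Cofree D.Δ.ρ (padicCoeffField D.ι),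
      (∀ σ : absoluteGaloisGroup K, (D.Δ.cofreeRepOver K) σ a = a) → (∃ j : ℕ, (3 : ℕ) ^ j • a = 0) → a = 0 :=
    fun a ha _ ↦ IrrK.noFixedTorsion_of_isResiduallyIrreducible D.Δ K (by decide) hK.1 hirr a ha
  -- ### (unr) outside `Σ ∪ {v ∣ 3}`
  have hunr := OrdinaryNewformDatum.cofreeRepOver_localMap_inr_apply_eq_self D.Δ (K := K)
    (↑(W'.sigmaPlacesFinset 3 K) : Set (HeightOneSpectrum (𝓞 K))) hSM
  -- ### a cyclotomic `ℤ₃`-extension with a topological generator; the discrete topology on `Λ_K`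
  obtain ⟨κ', hκ'⟩ := Literature.NumberTheory.EllipticCurves.exists_cyclotomicZpExtension_holds K 3
  obtain ⟨γ', hγ'⟩ := κ'.surjective (Multiplicative.ofAdd 1)
  haveI : Fact (κ'.IsTopGenerator γ') := ⟨hγ'⟩
  letI : TopologicalSpace (PowerSeries (PowerSeries (padicCoeffIntegers D.ι))) := ⊥
  haveI : DiscreteTopology (PowerSeries (PowerSeries (padicCoeffIntegers D.ι))) := ⟨rfl⟩
  -- ### finite generation of `X^Σ_ac(A_g)` and of the two-variable dual; the EXACT control map
  haveI := D.finiteDimensional_padicCoeffField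
  haveI : Module.Finite (PowerSeries (padicCoeffIntegers D.ι))
      (XBig κ (D.Δ.cofreeRepOver K) 𝔭' (↑(W'.sigmaPlacesFinset 3 K) : Set (HeightOneSpectrum (𝓞 K)))) :=
    SkinnerUrban2014.moduleFinite_XBig_newform D.Δ D.finiteDimensional_padicCoeffField K κ 𝔭'
      (↑(W'.sigmaPlacesFinset 3 K) : Set (HeightOneSpectrum (𝓞 K))) (W'.sigmaPlacesFinset 3 K).finite_toSet hSM
  haveI := ControlAt.module_finite_XBig_iterate κ κ' (D.Δ.cofreeRepOver K) 𝔭'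
    (↑(W'.sigmaPlacesFinset 3 K) : Set (HeightOneSpectrum (𝓞 K))) hglob hdec hunr
  have key := ControlAt.exists_controlMap κ κ' (D.Δ.cofreeRepOver K) 𝔭'
    (↑(W'.sigmaPlacesFinset 3 K) : Set (HeightOneSpectrum (𝓞 K))) hglob hdec hunr
  -- ### ring-theoretic clauses for the member's coefficient ring
  haveI : IsPrincipalIdealRing (padicCoeffIntegers D.ι) := D.isPrincipalIdealRing_coeffRing
  haveI : UniqueFactorizationMonoid (PowerSeries (PowerSeries (padicCoeffIntegers D.ι))) :=
    CoeffRing.uniqueFactorizationMonoid_powerSeries_powerSeries D.ι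
  -- ### two-variable torsion from the one-variable torsion premise + control (determinant trick)
  have hs := TwoVariableDescent.exists_constantCoeff_ne_zero_of_control
    (A := PowerSeries (padicCoeffIntegers D.ι))
    (XBig κ' (AnticyclotomicBigGaloisRep κ (D.Δ.cofreeRepOver K)) 𝔭'
      (↑(W'.sigmaPlacesFinset 3 K) : Set (HeightOneSpectrum (𝓞 K))))
    (XBig κ (D.Δ.cofreeRepOver K) 𝔭' (↑(W'.sigmaPlacesFinset 3 K) : Set (HeightOneSpectrum (𝓞 K))))
    hT key.choose key.choose_spec.2.2
  have htors₂ := TwoVariableDescent.isTorsion_of_exists_constantCoeff_ne_zero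
    (A := PowerSeries (padicCoeffIntegers D.ι))
    (XBig κ' (AnticyclotomicBigGaloisRep κ (D.Δ.cofreeRepOver K)) 𝔭'
      (↑(W'.sigmaPlacesFinset 3 K) : Set (HeightOneSpectrum (𝓞 K)))) hs
  -- ### the two-variable core at this member, for this cyclotomic `κ′`
  obtain ⟨Q₂, ⟨u, hu⟩, hle⟩ := hTV W' N' K Dt' hmult hsurj hN' hK hH hodd κ hκ γ 𝔭 h𝔭 he hf 𝔭' h𝔭' hne ι' hι'
    m hm D hirr hdec hι b hb ΩK Ωp Q hΩK hQ κ' γ' hκ' htors₂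
  -- ### descent of the characteristic ideal along `T_c ↦ 0` (JSW Cor. 3.4.2, kernel form), read in `𝓞_{ℂ₃}`
  have hdesc := TwoVariableDescent.charIdeal_le_map_constantCoeff_of_control
    (A := PowerSeries (padicCoeffIntegers D.ι))
    (XBig κ' (AnticyclotomicBigGaloisRep κ (D.Δ.cofreeRepOver K)) 𝔭'
      (↑(W'.sigmaPlacesFinset 3 K) : Set (HeightOneSpectrum (𝓞 K))))
    (XBig κ (D.Δ.cofreeRepOver K) 𝔭' (↑(W'.sigmaPlacesFinset 3 K) : Set (HeightOneSpectrum (𝓞 K))))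
    hT key.choose key.choose_spec.1 key.choose_spec.2.2
  refine ⟨0, ?_⟩
  rw [pow_zero, Ideal.span_singleton_one, Ideal.top_mul]
  refine (Ideal.map_mono hdesc).trans ?_
  rw [TwoVariableDescent.map_map_constantCoeff_eq b]
  exact TwoVariableDescent.map_constantCoeff_le_span_of_le_span_of_eq_unit_mul hle hu


/-! ## §2 The line needs only K1♯ᵈ: ♭B′ from Hsieh Thm B + `C_min` + K1♯ᵈ -/

set_option maxHeartbeats 800000 in
/-- **♭B′ `TwinWanFrameAtThreeMultTresT` (stmt-BirchSwinnertonDyer-27401) BY NAME from Hsieh Thm B + the consumer-minimal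
odd-`p` member/frame statement `C_min` over an all-split `K` (inline, VERBATIM the `hC` of p645093) + K1♯ᵈ** (K1♯ with the extra
binder (dec)). p645093's core proof with ONE inserted step: (dec) for every member `D` at depth `m ≥ 1` from the twin's
très-ramifié binder — `W′(ℚ₃)[3] = 0` (`twin_dec_of_forall_not_cube`), `K_𝔭′ → ℚ₃` at the degree-one prime `𝔭′`
(`degreeOne_of_splitsIn`, `AcSelmer.exists_ringHom_adicCompletion_padic_of_degreeOne`), no `Γ_{K_𝔭′}`-fixed geometric
`3`-torsion (`BigRep.hdec_geomPoints_of_padicTorsion`), transported to `A_{g_m}` through the congruence (b)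
(`RoadFFMember.forall_fixed_primary_eq_zero_cofreeRepOver`; `𝒪_m` free over `ℤ₃`). CONDITIONAL on {Hsieh Thm B PUBLISHED,
`C_min` PUBLISHED reading, K1♯ᵈ RESEARCH}; nothing is booked; BSD is proved for no curve.
[cite: Hsieh2014, Thm. B p. 712] [cite: Castella2020JIMJ, §2 Def. 2.10, Thm. 2.11] [cite: Skinner2016PacificMC, §2.6 (2-6-1), §3.1 (a)(b) (p. 192)]
[cite: Castella2018Erratum, Thm. 1.1 (iv), Lemma 2.1 (pp. 1–2)] -/
theorem twinWanFrameAtThreeMultTresT_of_thmB_of_allSplitMembersFrames_of_decIrredMemberRationalInclusion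
    (hB : Hsieh2014.thmB_exists_isHsiehLFunction_coeff_norm_eq_one_unrPeriod_anyLevel)
    (hC : ∀ {p : ℕ} [Fact p.Prime] (ι : PadicAlgCl p ≃+* ℂ) (W : WeierstrassCurve ℚ) [W.IsElliptic]
      [W.IsGloballyMinimal] (K : Type) [Field K] [NumberField K]
      (𝔭 : HeightOneSpectrum (𝓞 K)) (κ : ZpExtension K p) (γ : absoluteGaloisGroup K)
      [Fact (κ.IsTopGenerator γ)] {N : ℕ} [NeZero N] {f : CuspForm (CongruenceSubgroup.Gamma0 N) 2}
      (_ : IsNewformOf W f),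
      W.conductorNorm ℤ = N → p ≠ 2 → Mult W p → 3 ≤ N / p → Irr W p →
      IsImaginaryQuadratic K → Odd (NumberField.discr K) → SatisfiesHeegnerHypothesis N K →
      ((Ideal.span {(p : ℤ)}).primesOver (𝓞 K)).ncard = 2 →
      ((p : ℕ) : 𝓞 K) ∈ 𝔭.asIdeal →
      (∀ (w : InfinitePlace K) (x : 𝓞 K), x ∈ 𝔭.asIdeal ↔ ‖ι.symm (w.embedding (x : K))‖ < 1) →
      κ.IsAnticyclotomic →
      ∀ (a : unrIntegers p →+* PadicComplexInt p) (j : ℤ_[p] →+* unrIntegers p),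
        (∀ x : unrIntegers p, ((a x : PadicComplexInt p) : ℂ_[p]) = (x : ℂ_[p])) →
        (∀ x : ℤ_[p], ((j x : unrIntegers p) : ℂ_[p]) = algebraMap ℚ_[p] ℂ_[p] (x : ℚ_[p])) →
      ∃ (ΩK : ℂ) (Ωp : (unrIntegers p)ˣ) (L : UnrSeries p),
        ΩK ≠ 0 ∧ IsBDPLFunction ι 𝔭 κ γ f ΩK ((Ωp : unrIntegers p) : ℂ_[p]) L ∧
        ∀ m : ℕ, 1 ≤ m →
          ∃ (D : Skinner2016.HidaCongruentMember W p m) (Qm : PowerSeries (PadicComplexInt p)),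
            (∀ x : coeffField D.g, ι (D.ι x) = (x : ℂ)) ∧
            SkinnerUrban2014.IsResiduallyIrreducible D.Δ ∧
            IsBDPLFunctionWtSigmaInt ι 𝔭 κ γ D.g (W.sigmaPlacesFinset p K) ΩK ((Ωp : unrIntegers p) : ℂ_[p]) Qm ∧
            Ideal.span {Qm} ⊔ Ideal.span {(PowerSeries.C (((p : ℕ) : PadicComplexInt p) ^ m))} =
              Ideal.span {PowerSeries.map a (L * PowerSeries.map j (W.sigmaEulerElement p K κ))} ⊔
                Ideal.span {(PowerSeries.C (((p : ℕ) : PadicComplexInt p) ^ m))})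
    (hK1 :
    ∀ (W' : WeierstrassCurve ℚ) [W'.IsElliptic] [W'.IsGloballyMinimal] (N' : ℕ) [NeZero N']
      (K : Type) [Field K] [NumberField K] (Dt' : ModularParametrizationData W' N'),
      Mult W' 3 → W'.HasSurjectiveModNGaloisRep 3 → W'.conductorNorm ℤ = N' → IsImaginaryQuadratic K →
      SatisfiesHeegnerHypothesis N' K → Odd (NumberField.discr K) →
      ∀ (κ : ZpExtension K 3), κ.IsAnticyclotomic → ∀ (γ : absoluteGaloisGroup K) [Fact (κ.IsTopGenerator γ)]
        (𝔭 : HeightOneSpectrum (𝓞 K)), ((3 : ℕ) : 𝓞 K) ∈ 𝔭.asIdeal →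
        𝔭.asIdeal.ramificationIdx (𝓞 ℚ) = 1 → 𝔭.asIdeal.inertiaDeg (𝓞 ℚ) = 1 →
        ∀ (𝔭' : HeightOneSpectrum (𝓞 K)), ((3 : ℕ) : 𝓞 K) ∈ 𝔭'.asIdeal → 𝔭' ≠ 𝔭 →
        ∀ (ι' : PadicAlgCl 3 ≃+* ℂ), BranchInducesPrime 3 ι' 𝔭 →
        ∀ (m : ℕ), 1 ≤ m → ∀ (D : Skinner2016.HidaCongruentMember W' 3 m),
          SkinnerUrban2014.IsResiduallyIrreducible D.Δ →
          (∀ a : Cofree D.Δ.ρ (padicCoeffField D.ι),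
              (∀ σ : LocalGroup K (Sum.inl 𝔭'), (D.Δ.cofreeRepOver K) (localMap K (Sum.inl 𝔭') σ) a = a) →
              (∃ j : ℕ, (3 : ℕ) ^ j • a = 0) → a = 0) →
          (∀ x : coeffField D.g, ι' (D.ι x) = (x : ℂ)) →
        ∀ (b : padicCoeffIntegers D.ι →+* 𝓞_ℂ_[3]),
          (∀ x, ((b x : 𝓞_ℂ_[3]) : ℂ_[3]) = algebraMap (PadicAlgCl 3) ℂ_[3] (padicCoeffIntegers.toPadicAlgCl D.ι x)) →
        ∀ (ΩK : ℂ) (Ωp : (𝓞_ℂ_[3])ˣ) (Q : PowerSeries 𝓞_ℂ_[3]), ΩK ≠ 0 →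
          IsBDPLFunctionWtSigmaInt ι' 𝔭 κ γ D.g (W'.sigmaPlacesFinset 3 K) ΩK ((Ωp : 𝓞_ℂ_[3]) : ℂ_[3]) Q →
        ∀ [TopologicalSpace (PowerSeries (padicCoeffIntegers D.ι))]
          [ContinuousSMul (PowerSeries (padicCoeffIntegers D.ι))
            (BigRepModule (padicCoeffIntegers D.ι) 3 (Cofree D.Δ.ρ (padicCoeffField D.ι)))],
          Module.IsTorsion (PowerSeries (padicCoeffIntegers D.ι))
              (XBig κ (D.Δ.cofreeRepOver K) 𝔭' (↑(W'.sigmaPlacesFinset 3 K))) →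
            ∃ e : ℕ, Ideal.span {(PowerSeries.C ((3 : ℕ) : 𝓞_ℂ_[3]) : PowerSeries 𝓞_ℂ_[3]) ^ e} *
                (XBig.charIdeal κ (D.Δ.cofreeRepOver K) 𝔭' (↑(W'.sigmaPlacesFinset 3 K))).map (PowerSeries.map b) ≤
              Ideal.span {Q}) :
    Summit.BirchSwinnertonDyer.BirchSwinnertonDyer.Theses.UniversalToricDescent.TwinWanFrameAtThreeMultTresT := by
  intro W' _ _ N' _ K _ _ Dt' hmult hsurj hN' hK hH hodd hndvd κ hκ γ _ 𝔭 h𝔭 he hf 𝔭' h𝔭' hne ι' hι'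
  -- (dec) from the très-ramifié binder
  have hdec : ∀ Q : (W'.baseChange ℚ_[3]).toAffine.Point, 3 • Q = 0 → Q = 0 :=
    twin_dec_of_forall_not_cube W' hmult (forall_not_exists_pow_of_nonsplit_or_not_dvd W' (Or.inr hndvd))
  -- the odd-`p` member/frame statement's binders from ♭B′'s
  have hirr : Irr W' 3 := hasIrreducibleModPGaloisRep_of_hasSurjectiveModNGaloisRep W' 3 hsurj
  have hM : 3 ≤ N' / 3 := by
    have h11 := Pasten2024.eleven_le_level Dt'
    omega
  have hsplit : ((Ideal.span {((3 : ℕ) : ℤ)}).primesOver (𝓞 K)).ncard = 2 :=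
    ncard_primesOver_eq_two_of_degreeOne hK.1 h𝔭 he hf
  -- (dec) for every member at depth `m ≥ 1`: `W′(ℚ₃)[3] = 0` + `K_𝔭′ → ℚ₃` + the congruence (b)
  have hN0 : W'.conductorNorm ℤ ≠ 0 := (W'.conductorNorm_pos_holds).ne'
  haveI : NeZero (W'.conductorNorm ℤ / 3) :=
    ⟨(Nat.div_pos (Nat.le_of_dvd (Nat.pos_of_ne_zero hN0) (dvd_conductorNorm_of_mult hmult)) (by norm_num)).ne'⟩
  obtain ⟨heb, hfb⟩ := degreeOne_of_splitsIn hK.1 hsplit h𝔭'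
  obtain ⟨φ⟩ := AcSelmer.exists_ringHom_adicCompletion_padic_of_degreeOne 3 𝔭' h𝔭' heb hfb
  have h0 := BigRep.hdec_geomPoints_of_padicTorsion W' 3 K 𝔭' φ hdec
  have hdecD : ∀ (m : ℕ), 1 ≤ m → ∀ (D : Skinner2016.HidaCongruentMember W' 3 m),
      ∀ a : Cofree D.Δ.ρ (padicCoeffField D.ι),
        (∀ σ : LocalGroup K (Sum.inl 𝔭'), (D.Δ.cofreeRepOver K) (localMap K (Sum.inl 𝔭') σ) a = a) →
        (∃ j : ℕ, (3 : ℕ) ^ j • a = 0) → a = 0 := by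
    intro m hm D
    haveI := D.moduleFree_coeffRing
    exact RoadFFMember.forall_fixed_primary_eq_zero_cofreeRepOver D K hm
      (fun σ : absoluteGaloisGroup (𝔭'.adicCompletion K) => absGaloisRestrict K (𝔭'.adicCompletion K) σ) h0
  obtain ⟨ΩK, Ωp, L, hΩK, hL, hmem⟩ := hC ι' W' K 𝔭 κ γ Dt'.isNewformOf hN' (by decide) hmult hM hirr hK hodd hH hsplit h𝔭 hι'
    hκ (R1.unrToCpInt 3) (toUnr 3) (R1.coe_unrToCpInt 3) (coe_toUnr 3)
  have hΩp' : (((Units.map (R1.unrToCpInt 3 : unrIntegers 3 →* 𝓞_ℂ_[3]) Ωp : (𝓞_ℂ_[3])ˣ) : 𝓞_ℂ_[3]) : ℂ_[3]) =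
      ((Ωp : unrIntegers 3) : ℂ_[3]) := by
    rw [Units.coe_map, MonoidHom.coe_coe, R1.coe_unrToCpInt]
  have hΩp0 : ((Ωp : unrIntegers 3) : ℂ_[3]) ≠ 0 := fun h0 ↦
    Ωp.ne_zero ((ZeroMemClass.coe_eq_zero).mp h0)
  -- `μ(L) = 0` from Thm B (♭-witness moved across periods, p538896)
  have hμL : ∃ i : ℕ, IsUnit (PowerSeries.coeff i L) := by
    obtain ⟨ΩK₁, Ωp₁, Q, hΩK₁, hΩp₁, hQ, hμQ⟩ :=
      Summit.BirchSwinnertonDyer.BirchSwinnertonDyer.Theorems.UniversalToricDescentSelfMuZero.self_exists_isBDPLFunctionInt_coeff_norm_eq_one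
        hB W' N' K Dt' hsurj hK hH κ hκ γ 𝔭 h𝔭 he hf ι' hι'
    have hΩp₁0 : Ωp₁ ≠ 0 := fun h ↦ by rw [h, norm_zero] at hΩp₁; exact zero_ne_one hΩp₁
    obtain ⟨i, hi⟩ :=
      Summit.BirchSwinnertonDyer.BirchSwinnertonDyer.Theorems.UniversalToricDescentFlatMuTransfer.exists_coeff_norm_eq_one_of_isBDPLFunctionInt_of_isBDPLFunction
        hK hκ Fact.out hΩK₁ hΩK hΩp₁0 hΩp0 hQ hL hμQ
    exact ⟨i, (unrIntegers.isUnit_iff_norm_eq_one _).mpr hi⟩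
  refine ⟨ΩK, ((Ωp : unrIntegers 3) : ℂ_[3]), L, hΩK, hΩp0, hL, fun hT₀ ↦ ?_⟩
  refine twin_exists_forall_C_pow_mul_mem_span_of_cpIntMemberTower_of_isTorsion
    SkinnerUrban2014.prop323_XAc_equiv_XBigDecomp_holds W' N' K hmult hsurj hN' hK hH κ hκ γ 𝔭' h𝔭' hdec hT₀ L hμL
    fun m hm ↦ ?_
  exact (hmem m hm).elim fun D hD ↦ hD.elim fun Qm hQ ↦
    ⟨D, Qm, fun b hb hT ↦ hK1 W' N' K Dt' hmult hsurj hN' hK hH hodd κ hκ γ 𝔭 h𝔭 he hf 𝔭' h𝔭' hne ι' hι' m hm D hQ.2.1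
      (hdecD m hm D) hQ.1 b hb
      ΩK (Units.map (R1.unrToCpInt 3 : unrIntegers 3 →* 𝓞_ℂ_[3]) Ωp) Qm hΩK (hΩp' ▸ hQ.2.2.1) hT, hQ.2.2.2⟩

/-! ## §3 ♭B′ from the line's two Literature facts and the two-variable core at `p = 3` -/

set_option maxHeartbeats 400000 in
/-- **♭B′ `TwinWanFrameAtThreeMultTresT` BY NAME from Hsieh Thm B (item 20711), the print-faithful Castella fact
`…castella2020_thm211_members_frames_sigma_congruence_odd_nonsplit` (item 22593) and the TWO-VARIABLE CORE TV₃** — the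
composition §2 ∘ p645093's `allSplitMembersFrames_of_nonsplitMembersFrames` ∘ §1: the composition of a candidate skeleton
`membertower` v15 = {`stub_thmB`, `stub_pubMembersFramesCongruence`, `stub_twoVarCoreAtThree` := TV₃}. (The v14 stub K1♯ implies
K1♯ᵈ by discarding the (dec) binder, so v14 composes through §2 as well.) CONDITIONAL on {PUBLISHED, PUBLISHED, TV₃ RESEARCH};
nothing is booked; BSD is proved for no curve.
[cite: Hsieh2014, Thm. B p. 712] [cite: Castella2020JIMJ, §2 Def. 2.10, Thm. 2.11] [cite: JetchevSkinnerWan2017, §3.4, Cor. 3.4.2] -/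
theorem twinWanFrameAtThreeMultTresT_of_thmB_of_nonsplitMembersFrames_of_twoVarCoreAtThree
    (hB : Hsieh2014.thmB_exists_isHsiehLFunction_coeff_norm_eq_one_unrPeriod_anyLevel)
    (hC' : Castella2018.castella2020_thm211_members_frames_sigma_congruence_odd_nonsplit)
    (hTV :
    ∀ (W' : WeierstrassCurve ℚ) [W'.IsElliptic] [W'.IsGloballyMinimal] (N' : ℕ) [NeZero N']
      (K : Type) [Field K] [NumberField K] (Dt' : ModularParametrizationData W' N'),
      Mult W' 3 → W'.HasSurjectiveModNGaloisRep 3 → W'.conductorNorm ℤ = N' → IsImaginaryQuadratic K →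
      SatisfiesHeegnerHypothesis N' K → Odd (NumberField.discr K) →
      ∀ (κ : ZpExtension K 3), κ.IsAnticyclotomic → ∀ (γ : absoluteGaloisGroup K) [Fact (κ.IsTopGenerator γ)]
        (𝔭 : HeightOneSpectrum (𝓞 K)), ((3 : ℕ) : 𝓞 K) ∈ 𝔭.asIdeal →
        𝔭.asIdeal.ramificationIdx (𝓞 ℚ) = 1 → 𝔭.asIdeal.inertiaDeg (𝓞 ℚ) = 1 →
        ∀ (𝔭' : HeightOneSpectrum (𝓞 K)), ((3 : ℕ) : 𝓞 K) ∈ 𝔭'.asIdeal → 𝔭' ≠ 𝔭 →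
        ∀ (ι' : PadicAlgCl 3 ≃+* ℂ), BranchInducesPrime 3 ι' 𝔭 →
        ∀ (m : ℕ), 1 ≤ m → ∀ (D : Skinner2016.HidaCongruentMember W' 3 m),
          SkinnerUrban2014.IsResiduallyIrreducible D.Δ →
          (∀ a : Cofree D.Δ.ρ (padicCoeffField D.ι),
              (∀ σ : LocalGroup K (Sum.inl 𝔭'), (D.Δ.cofreeRepOver K) (localMap K (Sum.inl 𝔭') σ) a = a) →
              (∃ j : ℕ, (3 : ℕ) ^ j • a = 0) → a = 0) →
          (∀ x : coeffField D.g, ι' (D.ι x) = (x : ℂ)) →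
        ∀ (b : padicCoeffIntegers D.ι →+* 𝓞_ℂ_[3]),
          (∀ x, ((b x : 𝓞_ℂ_[3]) : ℂ_[3]) = algebraMap (PadicAlgCl 3) ℂ_[3] (padicCoeffIntegers.toPadicAlgCl D.ι x)) →
        ∀ (ΩK : ℂ) (Ωp : (𝓞_ℂ_[3])ˣ) (Q : PowerSeries 𝓞_ℂ_[3]), ΩK ≠ 0 →
          IsBDPLFunctionWtSigmaInt ι' 𝔭 κ γ D.g (W'.sigmaPlacesFinset 3 K) ΩK ((Ωp : 𝓞_ℂ_[3]) : ℂ_[3]) Q →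
        ∀ (κ' : ZpExtension K 3) (γ' : absoluteGaloisGroup K) [Fact (κ'.IsTopGenerator γ')], κ'.IsCyclotomic →
        ∀ [TopologicalSpace (PowerSeries (padicCoeffIntegers D.ι))]
          [TopologicalSpace (PowerSeries (PowerSeries (padicCoeffIntegers D.ι)))]
          [ContinuousSMul (PowerSeries (PowerSeries (padicCoeffIntegers D.ι)))
            (BigRepModule (PowerSeries (padicCoeffIntegers D.ι)) 3
              (BigRepModule (padicCoeffIntegers D.ι) 3 (Cofree D.Δ.ρ (padicCoeffField D.ι))))],
          Module.IsTorsion (PowerSeries (PowerSeries (padicCoeffIntegers D.ι)))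
              (XBig κ' (AnticyclotomicBigGaloisRep κ (D.Δ.cofreeRepOver K)) 𝔭' (↑(W'.sigmaPlacesFinset 3 K))) →
            ∃ Q₂ : PowerSeries (PowerSeries 𝓞_ℂ_[3]),
              (∃ u : (PowerSeries 𝓞_ℂ_[3])ˣ, PowerSeries.constantCoeff Q₂ = (u : PowerSeries 𝓞_ℂ_[3]) * Q) ∧
              (XBig.charIdeal κ' (AnticyclotomicBigGaloisRep κ (D.Δ.cofreeRepOver K)) 𝔭'
                  (↑(W'.sigmaPlacesFinset 3 K))).map (PowerSeries.map (PowerSeries.map b)) ≤ Ideal.span {Q₂}) :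
    Summit.BirchSwinnertonDyer.BirchSwinnertonDyer.Theses.UniversalToricDescent.TwinWanFrameAtThreeMultTresT :=
  twinWanFrameAtThreeMultTresT_of_thmB_of_allSplitMembersFrames_of_decIrredMemberRationalInclusion hB
    (UniversalToricDescentTwinWanFrameAtThreeMultTresTAllSplit.allSplitMembersFrames_of_nonsplitMembersFrames hC')
    (sharpDec_of_twoVarCoreAtThree hTV)

end Summit.BirchSwinnertonDyer.BirchSwinnertonDyer.Theorems.UniversalToricDescentTwinMemberRationalInclusionAtThreeOfTwoVarCore

end
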